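import Mathlib
import Summits.NavierStokesRegularity.NavierStokesRegularity.Theorems.EulerZoomLiouvillePowerGaugeEulerLiouvilleEnergySaturationLoc
import HarnessLib

/-!
# Energy saturation on the crux `EulerZoomLiouville.PowerGaugeEulerLiouville` — RATE ZERO: a profile with class-`ρ` large-scale data obeying
# the local energy equality of a SEPARABLE collapse (`2∫θ|V|² = ∫(|V|²+2P)⟪V,∇θ⟫`) VANISHES
# (crux = stmt-NavierStokesRegularity-19832, route №10 `EulerZoomLiouville`; line `logtime-breathers`, residue T4 `stub_powerClockRest`, rate `g = 0`)

Width seat `ns-ezl-w6` (cell ns-regularity-ideate, LEAD ns-typeII-p2).  Companion of `…EnergySaturationSlowRate` (rates `0 < g < 2/5`) at the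
borderline rate `g = 0` of Euler's power clocks: the SEPARABLE ansatz `u(τ, x) = (T−τ)⁻¹ W(x − x₀)`, `p(τ, x) = (T−τ)⁻² P(x − x₀)` (profile system
`W + (W·∇)W + ∇P = 0`, steady Euler with Rayleigh damping).  Its profile local energy equality — `ProfileEnergy.profile_local_energy_equality` at
`γ = 0` — has NO scale-derivative term: `2∫θ|W|² = ∫(|W|²+2P)⟪W,∇θ⟫` for every test function `θ`.  So the cut-off energy `J(R) = ∫σ(R⁻¹y)|W|²` IS
half the flux, and the tree's flux bound through the tail supremum (`exists_fluxWeight_le_of_sup_loc`, class-`ρ` data (A₁)(E₁)(D₁) + Poisson) bootstraps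
`J ≤ C R^m ⇒ J ≤ C' R^{m/2 − 5ρ/4}` down to a negative exponent: every ball is empty.

* `zeroRate_step`, `zeroRate_iterate` — the pure-real bootstrap (no ODE: `2J = F` pointwise in the scale);
* `ae_eq_zero_of_zeroRate_loc` — MAIN: (A₁), (E₁), (D₁) (`0 < ρ < 1`) + Poisson + the rate-zero equality ⇒ `V = 0` a.e.

WHAT THIS IS NOT: not NS regularity, not the crux — a profile-level lemma for one stratum of the crux CLASS 19832 on the MODEL lattice (`--supports`
stmt-19832). [folklore; cf. ChaeShvydkoy2013 §2.2 (2.12), BronziShvydkoy2015 Thm 1.1]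
-/

noncomputable section

-- flat `Theorems/<Route><Decl>…` files of one crux share the namespace of the crux (tree convention: `Summit.<S>.<S>.…`)
set_option linter.dupNamespace false

open MeasureTheory Set Filter Topology Metric Function TopologicalSpace
open scoped ENNReal NNReal RealInnerProductSpace ContDiff Laplacian

namespace Summit.NavierStokesRegularity.NavierStokesRegularity.Theorems.PowerGaugeEulerLiouville

open Literature.Analysis Literature.Analysis.FunctionSpaces Literature.Analysis.FluidPDE

namespace EnergySaturation

section Bootstrap

variable {ρ : ℝ} {c : ℝ≥0} {A : ℝ} {J F : ℝ → ℝ}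

/-- **THE RATE-ZERO BOOTSTRAP STEP** (pure real analysis).  `2J = F` on `(0,∞)`; the flux bound through the tail supremum with data exponent `ρ`
(conclusion of `exists_fluxWeight_le_of_sup_loc`).  If `J(R) ≤ C R^m` on `[L₁,∞)` (`m ≤ 1−2ρ`, `L₁ ≥ 1`) with admissible tail suprema
`C r^{m−(1−2ρ)} ≤ 3c`, then `J(R) ≤ C' R^{m/2 − 5ρ/4}` on `[L₁,∞)`. [folklore] -/
theorem zeroRate_step (hρ : 0 < ρ) (hA0 : 0 ≤ A)
    (hJF : ∀ R : ℝ, 0 < R → 2 * J R = F R)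
    (hflux : ∀ S : ℝ, 0 ≤ S → S ≤ 3 * c → ∀ L : ℝ, 1 ≤ L →
      (∀ R : ℝ, L ≤ R → J R ≤ R ^ (1 - 2 * ρ) * S) →
      ∀ r : ℝ, L ≤ r → |(2 + ρ) * r ^ (2 * ρ - 2) * F r| ≤ A * S ^ (1 / 2 : ℝ) * r ^ (-1 - (2 + ρ) / 4))
    {m C L₁ : ℝ} (hm : m ≤ 1 - 2 * ρ) (hC : 0 ≤ C) (hL₁ : 1 ≤ L₁)
    (hbound : ∀ R : ℝ, L₁ ≤ R → J R ≤ C * R ^ m)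
    (h3c : ∀ r : ℝ, L₁ ≤ r → C * r ^ (m - (1 - 2 * ρ)) ≤ 3 * c) :
    ∃ C' : ℝ, 0 ≤ C' ∧ ∀ R : ℝ, L₁ ≤ R → J R ≤ C' * R ^ (m / 2 - 5 * ρ / 4) := by
  have h2ρ : 0 < 2 + ρ := by linarith
  set μ : ℝ := m / 2 - 5 * ρ / 4 with hμ
  set B : ℝ := A * C ^ (1 / 2 : ℝ) / (2 + ρ) with hB
  have hB0 : 0 ≤ B := by rw [hB]; positivity
  refine ⟨B / 2, by positivity, fun r hr => ?_⟩
  have hr1 : 1 ≤ r := hL₁.trans hr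
  have hr0 : 0 < r := lt_of_lt_of_le one_pos hr1
  -- the tail supremum `S = C r^{m−(1−2ρ)}` from `r` on
  set S : ℝ := C * r ^ (m - (1 - 2 * ρ)) with hS
  have hS0 : 0 ≤ S := by rw [hS]; exact mul_nonneg hC (Real.rpow_nonneg hr0.le _)
  have hS3 : S ≤ 3 * c := h3c r hr
  have htail : ∀ R : ℝ, r ≤ R → J R ≤ R ^ (1 - 2 * ρ) * S := by
    intro R hR
    have hR0 : 0 < R := lt_of_lt_of_le hr0 hR
    have hRr : R ^ (m - (1 - 2 * ρ)) ≤ r ^ (m - (1 - 2 * ρ)) :=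
      Real.rpow_le_rpow_of_nonpos hr0 hR (by linarith)
    have hsplit : C * R ^ m = R ^ (1 - 2 * ρ) * (C * R ^ (m - (1 - 2 * ρ))) := by
      have : R ^ m = R ^ (1 - 2 * ρ) * R ^ (m - (1 - 2 * ρ)) := by
        rw [← Real.rpow_add hR0]; ring_nf
      rw [this]; ring
    calc J R ≤ C * R ^ m := hbound R (hr.trans hR)
      _ = R ^ (1 - 2 * ρ) * (C * R ^ (m - (1 - 2 * ρ))) := hsplit
      _ ≤ R ^ (1 - 2 * ρ) * S := by
          rw [hS]
          exact mul_le_mul_of_nonneg_left (mul_le_mul_of_nonneg_left hRr hC) (Real.rpow_nonneg hR0.le _)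
  have hfl := hflux S hS0 hS3 r hr1 htail r le_rfl
  have hw0 : 0 < (2 + ρ) * r ^ (2 * ρ - 2) := mul_pos h2ρ (Real.rpow_pos_of_pos hr0 _)
  rw [abs_mul, abs_of_pos hw0] at hfl
  have hS12 : S ^ (1 / 2 : ℝ) = C ^ (1 / 2 : ℝ) * r ^ ((m - (1 - 2 * ρ)) / 2) := by
    rw [hS, Real.mul_rpow hC (Real.rpow_nonneg hr0.le _), ← Real.rpow_mul hr0.le]
    congr 1; ring_nf
  -- `|F r| ≤ B r^μ`
  have hkey : |F r| ≤ (A * S ^ (1 / 2 : ℝ) * r ^ (-1 - (2 + ρ) / 4)) / ((2 + ρ) * r ^ (2 * ρ - 2)) := by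
    rw [le_div_iff₀ hw0]
    calc |F r| * ((2 + ρ) * r ^ (2 * ρ - 2)) = (2 + ρ) * r ^ (2 * ρ - 2) * |F r| := by ring
      _ ≤ A * S ^ (1 / 2 : ℝ) * r ^ (-1 - (2 + ρ) / 4) := hfl
  have hFle : |F r| ≤ B * r ^ μ := by
    refine hkey.trans (le_of_eq ?_)
    rw [hS12, hB, div_eq_iff hw0.ne']
    have hpow : r ^ ((m - (1 - 2 * ρ)) / 2) * r ^ (-1 - (2 + ρ) / 4) = r ^ μ * r ^ (2 * ρ - 2) := by
      rw [← Real.rpow_add hr0, ← Real.rpow_add hr0, hμ]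
      congr 1; ring
    calc A * (C ^ (1 / 2 : ℝ) * r ^ ((m - (1 - 2 * ρ)) / 2)) * r ^ (-1 - (2 + ρ) / 4)
        = A * C ^ (1 / 2 : ℝ) * (r ^ ((m - (1 - 2 * ρ)) / 2) * r ^ (-1 - (2 + ρ) / 4)) := by ring
      _ = A * C ^ (1 / 2 : ℝ) * (r ^ μ * r ^ (2 * ρ - 2)) := by rw [hpow]
      _ = A * C ^ (1 / 2 : ℝ) / (2 + ρ) * r ^ μ * ((2 + ρ) * r ^ (2 * ρ - 2)) := by
          field_simp
  -- `J r = F r / 2`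
  have hJ : J r = F r / 2 := by have := hJF r hr0; linarith
  rw [hJ]
  have : F r ≤ B * r ^ μ := (le_abs_self _).trans hFle
  calc F r / 2 ≤ B * r ^ μ / 2 := by linarith
    _ = B / 2 * r ^ μ := by ring

/-- **FINITELY MANY RATE-ZERO STEPS REACH A NEGATIVE EXPONENT** (`c > 0`): from `J(R) ≤ C₀ R^{1−2ρ}` on `[1,∞)`, `C₀ ≤ 3c`, there are `m < 0`,
`C ≥ 0`, `L₁ ≥ 1` with `J(R) ≤ C R^m` on `[L₁,∞)` (while `m ≥ 0` a step loses at least `5ρ/4`). [folklore] -/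
theorem zeroRate_iterate (hρ : 0 < ρ) (hc : 0 < (c : ℝ)) (hA0 : 0 ≤ A)
    (hJF : ∀ R : ℝ, 0 < R → 2 * J R = F R)
    (hflux : ∀ S : ℝ, 0 ≤ S → S ≤ 3 * c → ∀ L : ℝ, 1 ≤ L →
      (∀ R : ℝ, L ≤ R → J R ≤ R ^ (1 - 2 * ρ) * S) →
      ∀ r : ℝ, L ≤ r → |(2 + ρ) * r ^ (2 * ρ - 2) * F r| ≤ A * S ^ (1 / 2 : ℝ) * r ^ (-1 - (2 + ρ) / 4))
    {C₀ : ℝ} (hC₀ : 0 ≤ C₀) (hC₀3 : C₀ ≤ 3 * c)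
    (hbase : ∀ R : ℝ, 1 ≤ R → J R ≤ C₀ * R ^ (1 - 2 * ρ)) :
    ∃ m C L₁ : ℝ, m < 0 ∧ 0 ≤ C ∧ 1 ≤ L₁ ∧ ∀ R : ℝ, L₁ ≤ R → J R ≤ C * R ^ m := by
  set d : ℝ := 5 * ρ / 4 with hd
  have hd0 : 0 < d := by rw [hd]; positivity
  have hQ : ∀ k : ℕ, ∃ m C L₁ : ℝ, 0 ≤ C ∧ 1 ≤ L₁ ∧ (∀ R : ℝ, L₁ ≤ R → J R ≤ C * R ^ m) ∧
      (m < 0 ∨ (m ≤ 1 - 2 * ρ - k * d ∧ m ≤ 1 - 2 * ρ ∧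
        ∀ r : ℝ, L₁ ≤ r → C * r ^ (m - (1 - 2 * ρ)) ≤ 3 * c)) := by
    intro k
    induction k with
    | zero =>
      refine ⟨1 - 2 * ρ, C₀, 1, hC₀, le_rfl, hbase, Or.inr ⟨by simp, le_rfl, fun r hr => ?_⟩⟩
      rw [sub_self, Real.rpow_zero, mul_one]
      exact hC₀3
    | succ k ih =>
      obtain ⟨m, C, L₁, hC, hL₁, hb, hcase⟩ := ih
      rcases hcase with hneg | ⟨hmk, hm, h3c⟩
      · exact ⟨m, C, L₁, hC, hL₁, hb, Or.inl hneg⟩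
      by_cases hm0 : m < 0
      · exact ⟨m, C, L₁, hC, hL₁, hb, Or.inl hm0⟩
      push Not at hm0
      obtain ⟨C', hC'0, hb'⟩ := zeroRate_step hρ hA0 hJF hflux hm hC hL₁ hb h3c
      set mp : ℝ := m / 2 - 5 * ρ / 4 with hmp
      by_cases hmp0 : mp < 0
      · exact ⟨mp, C', L₁, hC'0, hL₁, hb', Or.inl hmp0⟩
      push Not at hmp0
      have hmp_lt : mp < m := by rw [hmp]; nlinarith
      have hmp_k : mp ≤ 1 - 2 * ρ - (↑(k + 1) : ℝ) * d := by
        rw [hmp, hd]; push_cast; rw [hd] at hmk; nlinarith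
      have hmp_le : mp ≤ 1 - 2 * ρ := by linarith
      have hexp : mp - (1 - 2 * ρ) < 0 := by linarith
      have htend : Tendsto (fun r : ℝ => C' * r ^ (mp - (1 - 2 * ρ))) atTop (𝓝 (C' * 0)) := by
        refine tendsto_const_nhds.mul ?_
        have := tendsto_rpow_neg_atTop (y := -(mp - (1 - 2 * ρ))) (by linarith)
        simpa using this
      rw [mul_zero] at htend
      have h3c0 : (0 : ℝ) < 3 * c := by positivity
      obtain ⟨L₂, hL₂δ, hL₂ge⟩ :=
        ((htend.eventually (gt_mem_nhds h3c0)).and (eventually_ge_atTop L₁)).exists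
      have hL₂1 : 1 ≤ L₂ := hL₁.trans hL₂ge
      have hL₂0 : 0 < L₂ := lt_of_lt_of_le one_pos hL₂1
      refine ⟨mp, C', L₂, hC'0, hL₂1, fun R hR => hb' R (hL₂ge.trans hR), Or.inr ⟨hmp_k, hmp_le, fun r hr => ?_⟩⟩
      have hr0 : 0 < r := lt_of_lt_of_le hL₂0 hr
      have hmono : r ^ (mp - (1 - 2 * ρ)) ≤ L₂ ^ (mp - (1 - 2 * ρ)) :=
        Real.rpow_le_rpow_of_nonpos hL₂0 hr hexp.le
      calc C' * r ^ (mp - (1 - 2 * ρ)) ≤ C' * L₂ ^ (mp - (1 - 2 * ρ)) := mul_le_mul_of_nonneg_left hmono hC'0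
        _ ≤ 3 * c := hL₂δ.le
  obtain ⟨k, hk⟩ := exists_nat_gt ((1 - 2 * ρ) / d)
  obtain ⟨m, C, L₁, hC, hL₁, hb, hcase⟩ := hQ k
  have hmneg : m < 0 := by
    rcases hcase with h | ⟨hmk, -, -⟩
    · exact h
    · have : (1 - 2 * ρ) < k * d := by rwa [div_lt_iff₀ hd0] at hk
      linarith
  exact ⟨m, C, L₁, hmneg, hC, hL₁, hb⟩

end Bootstrap

variable {ρ : ℝ}
  {V : EuclideanSpace ℝ (Fin 3) → EuclideanSpace ℝ (Fin 3)} {P : EuclideanSpace ℝ (Fin 3) → ℝ}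
  {G : EuclideanSpace ℝ (Fin 3) → EuclideanSpace ℝ (Fin 3) →L[ℝ] EuclideanSpace ℝ (Fin 3)}

/-- **RATE-ZERO (SEPARABLE) PROFILES WITH CLASS DATA ARE TRIVIAL.**  `(V, P, G)` with the thresholded class data (A₁), (E₁), (D₁) of DATA exponent
`0 < ρ < 1`, the weak Poisson equation, and the profile local energy EQUALITY of a SEPARABLE collapse — `ProfileEnergy.profile_local_energy_equality`
at `γ = 0`, stated in its literal shape `(2 − 5·0)∫θ|V|² = ∫(|V|²+2P)⟪V,∇θ⟫ + 0·∫|V|²⟪x,∇θ⟫` — for every test function: `V = 0` a.e.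
No energy, sub-extremality or regularity hypothesis. [folklore; cf. ChaeShvydkoy2013 §2.2] -/
theorem ae_eq_zero_of_zeroRate_loc (hρ : 0 < ρ) (hρ1 : ρ < 1)
    (hVm : AEStronglyMeasurable V volume) (hPm : AEStronglyMeasurable P volume)
    (hGm : AEStronglyMeasurable G volume)
    (hVG : HasWeakFDerivOn (⊤ : Opens (EuclideanSpace ℝ (Fin 3))) volume V G) {c : ℝ≥0}
    (hA : ∀ L : ℝ, 1 ≤ L → ∫⁻ y in ball (0 : EuclideanSpace ℝ (Fin 3)) L, ‖V y‖ₑ ^ 2 ≤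
      (c : ℝ≥0∞) * ENNReal.ofReal (L ^ (1 - 2 * ρ)))
    (hE : ∀ L : ℝ, 1 ≤ L →
      ∫⁻ y in ball (0 : EuclideanSpace ℝ (Fin 3)) L, ENNReal.ofReal (frobeniusNormSq (G y)) ≤
        ENNReal.ofReal (L ^ (1 - ρ)) * (ENNReal.ofReal ((1 - ρ) / (2 + ρ)) * (c : ℝ≥0∞)))
    (hD : ∀ L : ℝ, 1 ≤ L →
      ∫⁻ y in ball (0 : EuclideanSpace ℝ (Fin 3)) L, ‖P y‖ₑ ^ (3 / 2 : ℝ) ≤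
        ENNReal.ofReal (L ^ (2 - 2 * ρ)) * (ENNReal.ofReal ((2 - 2 * ρ) / (2 + ρ)) * (c : ℝ≥0∞)))
    (hPoisson : ∀ θ : EuclideanSpace ℝ (Fin 3) → ℝ, ContDiff ℝ (⊤ : ℕ∞) θ → HasCompactSupport θ →
      ∫ y, P y * (Δ θ) y = -∫ y, fderiv ℝ (fderiv ℝ θ) y (V y) (V y))
    (hEE : ∀ θ : EuclideanSpace ℝ (Fin 3) → ℝ, IsTestFunctionOn (⊤ : Opens (EuclideanSpace ℝ (Fin 3))) θ →
      (2 - 5 * (0 : ℝ)) * ∫ x, θ x * ‖V x‖ ^ 2 =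
        (∫ x, (‖V x‖ ^ 2 + 2 * P x) * ⟪V x, gradient θ x⟫) +
          (0 : ℝ) * ∫ x, ‖V x‖ ^ 2 * ⟪x, gradient θ x⟫) :
    V =ᵐ[volume] 0 := by
  have hc0 : (0 : ℝ) ≤ c := c.2
  have hV2 : LocallyIntegrable (fun y => ‖V y‖ ^ 2) volume := locallyIntegrable_norm_sq_of_growth_loc hVm hA
  obtain ⟨σ, hσs, hσc, h0, h1, hone, hzero, -⟩ := exists_radialCutoff
  have hσ : IsTestFunctionOn (⊤ : Opens (EuclideanSpace ℝ (Fin 3))) σ := ⟨hσs, hσc, fun _ _ => trivial⟩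
  set J : ℝ → ℝ := fun R => ∫ y, σ (R⁻¹ • y) * ‖V y‖ ^ 2 with hJ
  set F : ℝ → ℝ := fun r => ∫ x, (‖V x‖ ^ 2 + 2 * P x) * ⟪V x, gradient (fun z => σ (r⁻¹ • z)) x⟫ with hF
  -- ### a NEGATIVE power bound on `J` at large scales
  have hpow : ∃ m C L₁ : ℝ, m < 0 ∧ 0 ≤ C ∧ 1 ≤ L₁ ∧ ∀ R : ℝ, L₁ ≤ R → J R ≤ C * R ^ m := by
    by_cases hc : (c : ℝ) = 0
    · refine ⟨-1, 0, 1, by norm_num, le_rfl, le_rfl, fun R hR => ?_⟩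
      have hR0 : 0 < R := lt_of_lt_of_le one_pos hR
      have h := normEnergy_le_of_growth_loc (ρ := ρ) h0 h1 hzero hVm hA hR
      rw [hc, mul_zero] at h
      have hRp : 0 < R ^ (2 * ρ - 1) := Real.rpow_pos_of_pos hR0 _
      have hJle : J R ≤ 0 := by
        have : R ^ (2 * ρ - 1) * J R ≤ R ^ (2 * ρ - 1) * 0 := by rw [mul_zero]; exact h
        exact le_of_mul_le_mul_left this hRp
      simpa using hJle
    have hcpos : 0 < (c : ℝ) := lt_of_le_of_ne hc0 (Ne.symm hc)
    -- `2 J = F` from the rate-zero equality for the rescaled cut-offs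
    have hJF : ∀ R : ℝ, 0 < R → 2 * J R = F R := by
      intro R hR
      have h := hEE _ (isTestFunctionOn_comp_inv_smul hσ hR.ne')
      simp only [hJ, hF]
      linarith
    obtain ⟨A, hA0, hfluxW⟩ := exists_fluxWeight_le_of_sup_loc hρ hρ1 hσ h0 h1 hone hzero hVm hPm hGm hVG hA hE hD
      hPoisson
    have hflux : ∀ S : ℝ, 0 ≤ S → S ≤ 3 * c → ∀ L : ℝ, 1 ≤ L →
        (∀ R : ℝ, L ≤ R → J R ≤ R ^ (1 - 2 * ρ) * S) →
        ∀ r : ℝ, L ≤ r → |(2 + ρ) * r ^ (2 * ρ - 2) * F r| ≤ A * S ^ (1 / 2 : ℝ) * r ^ (-1 - (2 + ρ) / 4) :=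
      fun S hS hS3 L hL hsup r hr => hfluxW S hS hS3 L hL hsup r hr
    set C₀ : ℝ := (3 : ℝ) ^ (1 - 2 * ρ) * c with hC₀
    have hC₀0 : 0 ≤ C₀ := by rw [hC₀]; positivity
    have hC₀3 : C₀ ≤ 3 * c := by
      have h3 : (3 : ℝ) ^ (1 - 2 * ρ) ≤ 3 := by
        conv_rhs => rw [← Real.rpow_one 3]
        exact Real.rpow_le_rpow_of_exponent_le (by norm_num) (by linarith)
      rw [hC₀]; gcongr
    have hbase : ∀ R : ℝ, 1 ≤ R → J R ≤ C₀ * R ^ (1 - 2 * ρ) := by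
      intro R hR
      have hR0 : 0 < R := lt_of_lt_of_le one_pos hR
      have h := normEnergy_le_of_growth_loc (ρ := ρ) h0 h1 hzero hVm hA hR
      have hRR : R ^ (1 - 2 * ρ) * R ^ (2 * ρ - 1) = 1 := by rw [← Real.rpow_add hR0]; norm_num
      calc J R = R ^ (1 - 2 * ρ) * (R ^ (2 * ρ - 1) * J R) := by rw [← mul_assoc, hRR, one_mul]
        _ ≤ R ^ (1 - 2 * ρ) * ((3 : ℝ) ^ (1 - 2 * ρ) * c) :=
            mul_le_mul_of_nonneg_left h (Real.rpow_nonneg hR0.le _)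
        _ = C₀ * R ^ (1 - 2 * ρ) := by rw [hC₀]; ring
    exact zeroRate_iterate hρ hcpos hA0 hJF hflux hC₀0 hC₀3 hbase
  obtain ⟨m, C, L₁, hm, hC, hL₁, hb⟩ := hpow
  -- ### CONCLUSION: the energy of every ball vanishes
  have hballzero : ∀ L₀ : ℝ, 0 < L₀ → ∫⁻ y in ball (0 : EuclideanSpace ℝ (Fin 3)) L₀, ‖V y‖ₑ ^ 2 = 0 := by
    intro L₀ hL₀
    refine le_antisymm (ENNReal.le_of_forall_pos_le_add fun δ hδ _ => ?_) zero_le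
    rw [zero_add]
    have htend : Tendsto (fun L : ℝ => C * L ^ m) atTop (𝓝 (C * 0)) := by
      refine tendsto_const_nhds.mul ?_
      have := tendsto_rpow_neg_atTop (y := -m) (by linarith)
      simpa using this
    rw [mul_zero] at htend
    have hev := (htend.eventually (gt_mem_nhds (show (0 : ℝ) < δ from hδ))).and
      (eventually_ge_atTop (max L₀ L₁))
    obtain ⟨L, hLδ, hLge⟩ := hev.exists
    have hLL₁ : L₁ ≤ L := (le_max_right _ _).trans hLge
    have hL0 : 0 < L := lt_of_lt_of_le (lt_of_lt_of_le one_pos hL₁) hLL₁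
    have hLL₀ : L₀ ≤ L := (le_max_left _ _).trans hLge
    have h1 := lintegral_ball_sq_le_cutoffEnergy hσs.continuous hσc h0 hone hV2 hL0
    calc ∫⁻ y in ball (0 : EuclideanSpace ℝ (Fin 3)) L₀, ‖V y‖ₑ ^ 2
        ≤ ∫⁻ y in ball (0 : EuclideanSpace ℝ (Fin 3)) L, ‖V y‖ₑ ^ 2 := lintegral_mono_set (ball_subset_ball hLL₀)
      _ ≤ ENNReal.ofReal (J L) := h1
      _ ≤ ENNReal.ofReal (C * L ^ m) := ENNReal.ofReal_le_ofReal (hb L hLL₁)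
      _ ≤ (δ : ℝ≥0∞) := by
          rw [← ENNReal.ofReal_coe_nnreal]; exact ENNReal.ofReal_le_ofReal hLδ.le
  have hball_ae : ∀ n : ℕ, ∀ᵐ y ∂(volume.restrict (ball (0 : EuclideanSpace ℝ (Fin 3)) ((n : ℝ) + 1))), V y = 0 := by
    intro n
    have h := hballzero ((n : ℝ) + 1) (by positivity)
    rw [lintegral_eq_zero_iff' (hVm.restrict.enorm.pow_const 2)] at h
    filter_upwards [h] with y hy
    simpa using hy
  have hunion : (⋃ n : ℕ, ball (0 : EuclideanSpace ℝ (Fin 3)) ((n : ℝ) + 1)) = univ := by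
    refine eq_univ_of_forall fun y => mem_iUnion.2 ?_
    obtain ⟨n, hn⟩ := exists_nat_gt ‖y‖
    exact ⟨n, by rw [mem_ball, dist_zero_right]; linarith⟩
  have h := (ae_restrict_iUnion_iff (μ := (volume : Measure (EuclideanSpace ℝ (Fin 3))))
    (fun n : ℕ => ball (0 : EuclideanSpace ℝ (Fin 3)) ((n : ℝ) + 1)) (fun y => V y = 0)).2 hball_ae
  rw [hunion, Measure.restrict_univ] at h
  exact h

end EnergySaturation

end Summit.NavierStokesRegularity.NavierStokesRegularity.Theorems.PowerGaugeEulerLiouville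

end
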